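import Literature.MathematicalPhysics.QuantumManyBody.BoseGasSubcellNoClumping
import Summits.AtomisticToContinuum.BoseEinsteinCondensation.Theorems.BECDyadicChainingBaseCoherentMassOccupationLeDensity
import Summits.AtomisticToContinuum.BoseEinsteinCondensation.Theorems.BECDyadicChainingBaseCoherentMassNoClumpingAux
import HarnessLib

/-!
# Crux `BECTangentRigidity.TangentTransfer` (stmt-AtomisticToContinuum-13033), line `registered` (v2):
# STUB `stub_noClumping` — no clumping of the flat cell modes at the mesoscopic scale

For every repulsive finite-range pair potential `v` (hard cores allowed) with positive scattering
length, every `η ∈ (0,1)` and every `M ≥ 1` there is `ρ₀ = ρ₀(η, M, v) > 0` such that for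
`0 < ρ < ρ₀`, eventually in `N`, every `δ`-near-minimiser `Ψ` (`δ = 1`) of the Dirichlet energy in
the box of side `L = (N/ρ)^{1/3}` and every dyadic level `k` with `M/√ρ ≤ L/2^k < 2M/√ρ` satisfy:
the total over-occupation of the `8^k` flat cell modes `dyMode L k m` beyond the fair share
`(1+η)N/8^k` is at most `ηN`, `Σ_m (⟨dyMode_m, γ_Ψ dyMode_m⟩ - (1+η)N/8^k)₊ ≤ ηN` (truncated
subtraction in `ℝ≥0∞`).

Proof: a flat-mode occupation is at most the expected number of particles in its cell
(`stub_occupationLeDensity` of route BECDyadicChaining, proved: the diagonal of the one-particle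
density matrix is the density); the expected number of particles in a dyadic cell is the
mass-average over the particle-to-cell assignments `σ` of the occupation number
(`sum_setLIntegral_mem_dyCell_eq`); and the Literature theorem
`Literature.MathematicalPhysics.QuantumManyBody.BoseGas.sum_massAverage_card_tsub_le_of_scatteringLength_pos`
(`BoseGasSubcellNoClumping.lean`: the cell method of the Lieb–Yngvason lower bound run state-wise
on the big Dirichlet box with the convexity bookkeeping keeping the linear excess,
`Σ_c (n_c - n̄)² ≥ 2ηn̄ Σ_c (n_c - (1+η)n̄)₊`, crowded cells by superadditivity, against the Dyson
upper bound; the mass-averaged excess is `o(1)·N/η ≤ ηN` for `ρ < ρ₀(η, M, v)`, then Jensen) bounds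
the total excess of the expected cell numbers over the fair share by `ηN`.  The statement is false
for zero scattering length (free Dirichlet ground state: the central cells hold up to `8×` the fair
share), hence the hypothesis `0 < scatteringLength v`.

References: E. H. Lieb, R. Seiringer, J. P. Solovej, J. Yngvason, *The Mathematics of the Bose Gas
and its Condensation* (2005), (2.52)–(2.58), Thm. 2.2, Thm. 2.4, Lemma 5.2; E. H. Lieb,
J. Yngvason, Phys. Rev. Lett. 80 (1998) 2504.
-/

noncomputable section

open MeasureTheory Filter Set
open scoped ENNReal NNReal Topology BigOperators

namespace Summit.AtomisticToContinuum.BoseEinsteinCondensation.Cruxes.TangentTransfer.Birth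

open Literature.MathematicalPhysics.QuantumManyBody.BoseGas
open Summit.AtomisticToContinuum.BoseEinsteinCondensation.Theorems.BaseCoherentMass
  (stub_occupationLeDensity sum_setLIntegral_mem_dyCell_eq)

/-- **STUB `stub_noClumping` — no clumping of the flat cell modes at the mesoscopic scale**
(registered signature of the line `registered`, skeleton v2, of the crux `TangentTransfer`).  For
every repulsive finite-range `v` with positive scattering length, every `η ∈ (0,1)` and every
`M ≥ 1` there is `ρ₀ > 0` such that for `0 < ρ < ρ₀`, eventually in `N`, there is `δ > 0` (namely
`δ = 1`) such that for every `δ`-near-minimiser `Ψ` of the Dirichlet energy in the box of side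
`L = (N/ρ)^{1/3}` and every dyadic level `k` with `M/√ρ ≤ L/2^k < 2M/√ρ`,
`Σ_m (⟨dyMode_m, γ_Ψ dyMode_m⟩ - (1+η)N/8^k)₊ ≤ ηN`: `stub_occupationLeDensity` (occupation ≤
expected cell number), `sum_setLIntegral_mem_dyCell_eq` (expected cell number = mass-average of
the occupation number over the assignments), re-indexing of the cells by `finFunctionFinEquiv`,
and `sum_massAverage_card_tsub_le_of_scatteringLength_pos`. [folklore] -/
theorem stub_noClumping :
    ∀ v : ℝ → ℝ≥0∞, IsRepulsiveFiniteRange v → 0 < scatteringLength v →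
      ∀ η : ℝ, 0 < η → η < 1 → ∀ M : ℝ, 1 ≤ M →
      ∃ ρ₀ : ℝ, 0 < ρ₀ ∧ ∀ ρ : ℝ, 0 < ρ → ρ < ρ₀ →
        ∀ᶠ N : ℕ in atTop, ∃ δ : ℝ≥0∞, 0 < δ ∧ ∀ Ψ : TrialState N (sideLength ρ N),
          energy v Ψ ≤ groundStateEnergy v N (sideLength ρ N) + δ →
          ∀ k : ℕ, M / Real.sqrt ρ ≤ sideLength ρ N / 2 ^ k →
            sideLength ρ N / 2 ^ k < 2 * (M / Real.sqrt ρ) →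
            ∑ m : Fin 3 → Fin (2 ^ k),
                (occupation N (dyMode (sideLength ρ N) k m) Ψ.ψ -
                  ENNReal.ofReal ((1 + η) * N / 8 ^ k)) ≤ ENNReal.ofReal (η * N) := by
  intro v hv ha η hη hη1 M hM
  have hMpos : 0 < M := by linarith
  obtain ⟨ρ₀, hρ₀, H⟩ := sum_massAverage_card_tsub_le_of_scatteringLength_pos hv ha hη hη1.le hMpos
  refine ⟨ρ₀, hρ₀, fun ρ hρ hρlt => ?_⟩
  filter_upwards [H ρ hρ hρlt, eventually_gt_atTop 0] with N hN hNpos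
  refine ⟨1, one_pos, fun Ψ hΨ k hk1 hk2 => ?_⟩
  have hL : 0 < sideLength ρ N := sideLength_pos_of_pos hρ hNpos
  calc ∑ m : Fin 3 → Fin (2 ^ k),
        (occupation N (dyMode (sideLength ρ N) k m) Ψ.ψ - ENNReal.ofReal ((1 + η) * N / 8 ^ k))
      ≤ ∑ m : Fin 3 → Fin (2 ^ k),
          ((∑ j : Fin N, ∫⁻ X in {X : Config N | X j ∈ dyCell (sideLength ρ N) k m},
              (‖Ψ.ψ X‖₊ : ℝ≥0∞) ^ 2) - ENNReal.ofReal ((1 + η) * N / 8 ^ k)) :=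
        Finset.sum_le_sum fun m _ =>
          tsub_le_tsub_right (stub_occupationLeDensity N (sideLength ρ N) Ψ k m) _
    _ = ∑ m : Fin 3 → Fin (2 ^ k), ((∑ σ : Fin N → Fin ((2 ^ k) ^ 3),
          (∫⁻ X in cellSet (2 ^ k) (sideLength ρ N / 2 ^ k) σ, (‖Ψ.ψ X‖₊ : ℝ≥0∞) ^ 2) *
            ((Finset.univ.filter fun j => σ j = finFunctionFinEquiv m).card : ℝ≥0∞)) -
          ENNReal.ofReal ((1 + η) * N / 8 ^ k)) := by
        simp only [sum_setLIntegral_mem_dyCell_eq hL Ψ k]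
    _ = ∑ c : Fin ((2 ^ k) ^ 3), ((∑ σ : Fin N → Fin ((2 ^ k) ^ 3),
          (∫⁻ X in cellSet (2 ^ k) (sideLength ρ N / 2 ^ k) σ, (‖Ψ.ψ X‖₊ : ℝ≥0∞) ^ 2) *
            ((Finset.univ.filter fun j => σ j = c).card : ℝ≥0∞)) -
          ENNReal.ofReal ((1 + η) * N / 8 ^ k)) :=
        Equiv.sum_comp finFunctionFinEquiv (fun c : Fin ((2 ^ k) ^ 3) =>
          (∑ σ : Fin N → Fin ((2 ^ k) ^ 3),
            (∫⁻ X in cellSet (2 ^ k) (sideLength ρ N / 2 ^ k) σ, (‖Ψ.ψ X‖₊ : ℝ≥0∞) ^ 2) *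
              ((Finset.univ.filter fun j => σ j = c).card : ℝ≥0∞)) -
            ENNReal.ofReal ((1 + η) * N / 8 ^ k))
    _ ≤ ENNReal.ofReal (η * N) := hN Ψ hΨ k hk1 hk2

end Summit.AtomisticToContinuum.BoseEinsteinCondensation.Cruxes.TangentTransfer.Birth

end
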